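import Summits.CriticalPhenomena.PercolationContinuityZ3.Theorems.Transplant.StepGraphDefs
import Literature.Probability.Percolation.KozmaNitzanBoxes
import Literature.Probability.Percolation.SitePaths
import HarnessLib

/-!
# PHASE 2 / F2 — `KozmaNitzanBoxes` re-typed from `zdGraph d` to `stepGraph d S` (interface (I-a) dry run)

builds on p205010 (kernel theorem, internal audit signed; external expert review pending) — nothing in this file uses p205010.
Generalisation of `Literature/Probability/Percolation/KozmaNitzanBoxes.lean` (Kozma–Nitzan 2024 §4 pp. 15–21, the `ℤ^d` model) from
`zdGraph d` to `stepGraph d S` for an admissible step set `S` (`Transplant/StepGraphDefs.lean`).  Lane `prim-bschramm`, README §PHASE 2,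
file F2 (lead ack 06:22Z); seat `prim-bschramm-p2`; helper file (`--supports stmt-CriticalPhenomena-4575`).  No definitions, no sorries.

FINDING OF THE DRY RUN (numbers in the seat's STATUS): of the 66 declarations of the original (848 lines), 52 are graph-free (boxes,
clamps, windows, plaquettes, cubes, seed edge SETS, counting) and are REUSED VERBATIM (imported, not copied); 4 mention `zdGraph d` only
through axis seed edges / lattice paths whose openness is what matters (`pathIn_openGraph_of_edgesIn_subset`, `openConn_of_seedEdges_subset`,
`card_seedEdges_le`, `seedEdges`) and are reused as they stand because `zdGraph d ≤ stepGraph d S`; the 10 genuinely graph-dependent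
statements are re-typed below.  Two of them CHANGE SHAPE (not only the graph argument): `exists_dir_of_mem_outerBoundary` (with diagonal
steps an outer-boundary vertex may leave the box in several coordinates at once — "each such vertex has exactly one edge connecting it to
`B⟨j⟩`", KN p. 18, fails; the re-typed lemma returns one leaving coordinate, the INNER NEIGHBOUR `y` on that face, and the other coordinates
within `[Lo − 1, Hi + 1]`) and `exists_winHyp_of_mem_outerBoundary` (conclusion `(stepGraph d S).Adj y x ∧ x i = y i + σ` instead of
`x = y + σ e_i`).  Everything else is the original statement with `stepGraph d S` for `zdGraph d`.

* `StepKN.innerBoundary_mono_graph`, `StepKN.mem_innerBoundary_Icc` (inner boundary of a box = its faces, for range-1 steps ⊇ units),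
  `StepKN.mem_Icc_enlarge_one_of_mem_outerBoundary`, `StepKN.outerBoundary_enlarge_subset`, `StepKN.not_mem_innerBoundary_of_enlarge_succ_subset`;
* `StepKN.exists_pathIn_Icc` (staircase paths are `stepGraph` paths); `StepKN.exists_dir_of_mem_outerBoundary` (repaired shape);
  `StepKN.exists_winHyp_of_mem_outerBoundary` (repaired shape); `StepKN.seedEdges_subset_edgeSet`;
* `StepKN.card_neighborFinset_le` (degree `≤ 2|S|`), `StepKN.card_edgesIn_le` (`|E(Λ)| ≤ 2|S|·|Λ|`, replacing `2d·|Λ|`).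

[cite: KozmaNitzan2024, §4 pp. 15–21 (boxes, ∂_iv, ∂_ev, plaquettes, seeds)] [cite: GrimmettPercolation1999, §7.2 (boxes, seeds)]
-/

noncomputable section

namespace Summit.CriticalPhenomena.PercolationContinuityZ3.Theorems

namespace Transplant

namespace StepKN

open Literature.Probability.Percolation Literature.Probability.LatticeModels
open Literature.Probability.Percolation.KozmaNitzan

variable {d : ℕ} {S : Finset (Site d)}

/-! ## Inner and outer vertex boundaries of boxes in `stepGraph d S` -/

/-- The inner vertex boundary is monotone in the graph. [folklore] -/
theorem innerBoundary_mono_graph {V : Type*} [DecidableEq V] {G G' : SimpleGraph V} [G.LocallyFinite] [G'.LocallyFinite]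
    (h : G ≤ G') (Λ : Finset V) : innerBoundary G Λ ⊆ innerBoundary G' Λ := by
  intro x hx
  rw [mem_innerBoundary_iff] at hx ⊢
  obtain ⟨hxΛ, y, hy, hxy⟩ := hx
  exact ⟨hxΛ, y, hy, h hxy⟩

/-- **Inner vertex boundary of a box in `stepGraph d S`** (`S` admissible): a vertex of `Icc lo hi` has a neighbour outside iff one of
its coordinates is extreme — as for `ℤ^d` (`KozmaNitzan.mem_innerBoundary_Icc`), because steps have range `≤ 1` and contain the units.
[cite: KozmaNitzan2024, §4 p. 15 (∂_iv)] -/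
theorem mem_innerBoundary_Icc (hS : AdmissibleSteps d S) {lo hi x : Site d} :
    x ∈ innerBoundary (stepGraph d S) (Finset.Icc lo hi) ↔ x ∈ Finset.Icc lo hi ∧ ∃ i, x i = lo i ∨ x i = hi i := by
  constructor
  · intro hx
    rw [mem_innerBoundary_iff] at hx
    obtain ⟨hxB, y, hy, hxy⟩ := hx
    refine ⟨hxB, ?_⟩
    rw [KozmaNitzan.mem_Icc_iff] at hxB hy
    push Not at hy
    obtain ⟨j, hj⟩ := hy
    refine ⟨j, ?_⟩
    have h1 := abs_le.1 (stepGraph_abs_sub_le hS hxy j)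
    have h2 := hxB j
    omega
  · intro hx
    exact innerBoundary_mono_graph (zdGraph_le_stepGraph hS) _ (KozmaNitzan.mem_innerBoundary_Icc.2 hx)

/-- **Outer vertex boundary of a box in `stepGraph d S`** lies in the enlarged box `Icc (lo − 1) (hi + 1)` (range-1 steps).
[cite: KozmaNitzan2024, §4 p. 15 (∂_ev)] -/
theorem mem_Icc_enlarge_one_of_mem_outerBoundary (hS : AdmissibleSteps d S) {lo hi x : Site d}
    (hx : x ∈ outerBoundary (stepGraph d S) (Finset.Icc lo hi)) : x ∈ Finset.Icc (lo - 1) (hi + 1) := by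
  rw [mem_outerBoundary_iff] at hx
  obtain ⟨-, y, hy, hxy⟩ := hx
  rw [KozmaNitzan.mem_Icc_iff] at hy ⊢
  intro j
  have h1 := abs_le.1 (stepGraph_abs_sub_le hS hxy j)
  have h2 := hy j
  simp only [Pi.sub_apply, Pi.add_apply, Pi.one_apply]
  omega

/-- `∂_ev B⟨R⟩ ⊆ B⟨R+1⟩` in `stepGraph d S`. [cite: KozmaNitzan2024, §4 p. 15] -/
theorem outerBoundary_enlarge_subset (hS : AdmissibleSteps d S) (lo hi : Site d) (R : ℕ) :
    outerBoundary (stepGraph d S) (Finset.Icc (lo - R) (hi + R)) ⊆ Finset.Icc (lo - (R + 1 : ℕ)) (hi + (R + 1 : ℕ)) := by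
  intro x hx
  have := mem_Icc_enlarge_one_of_mem_outerBoundary hS hx
  rw [KozmaNitzan.mem_Icc_iff] at this ⊢
  intro i
  have h := this i
  simp only [Pi.sub_apply, Pi.add_apply, Pi.natCast_apply, Pi.one_apply, Nat.cast_add, Nat.cast_one] at h ⊢
  omega

/-- Every vertex of `B⟨R⟩` has all its `stepGraph` neighbours in `B⟨R+1⟩`, so it is not an inner-boundary vertex of any set containing
`B⟨R+1⟩`. [folklore] -/
theorem not_mem_innerBoundary_of_enlarge_succ_subset (hS : AdmissibleSteps d S) {lo hi : Site d} {R : ℕ} {D : Finset (Site d)}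
    (hD : Finset.Icc (lo - (R + 1 : ℕ)) (hi + (R + 1 : ℕ)) ⊆ D) {x : Site d} (hx : x ∈ Finset.Icc (lo - R) (hi + R)) :
    x ∉ innerBoundary (stepGraph d S) D := by
  rw [mem_innerBoundary_iff]
  rintro ⟨-, y, hy, hxy⟩
  apply hy
  apply hD
  rw [KozmaNitzan.mem_Icc_iff] at hx ⊢
  intro j
  have h1 := abs_le.1 (stepGraph_abs_sub_le hS hxy j)
  have h2 := hx j
  simp only [Pi.sub_apply, Pi.add_apply, Pi.natCast_apply, Nat.cast_add, Nat.cast_one, Pi.one_apply] at h2 ⊢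
  omega

/-! ## Paths inside a box -/

/-- Two vertices of a box are joined by a `stepGraph` path inside the box (the `ℤ^d` staircase path, `zdGraph d ≤ stepGraph d S`).
[folklore] -/
theorem exists_pathIn_Icc (hS : AdmissibleSteps d S) {lo hi x y : Site d} (hx : x ∈ Finset.Icc lo hi) (hy : y ∈ Finset.Icc lo hi) :
    PathIn (stepGraph d S) (↑(Finset.Icc lo hi) : Set (Site d)) x y :=
  (KozmaNitzan.exists_pathIn_Icc hx hy).mono_graph (zdGraph_le_stepGraph hS)

/-! ## The outer boundary of a box: a leaving direction and the inner neighbour (REPAIRED SHAPE) -/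

/-- **A vertex of the outer boundary of `Icc Lo Hi` in `stepGraph d S` leaves the box through SOME coordinate `i`**, upwards
(`σ = 1`, `x_i = Hi_i + 1`) or downwards (`σ = −1`, `x_i = Lo_i − 1`); it has a `stepGraph`-neighbour `y` in the box lying on the
corresponding face (`y_i = Hi_i` resp. `Lo_i`), and ALL coordinates of `x` are within one of the box (`Lo − 1 ≤ x ≤ Hi + 1`).  For
`ℤ^d` (KN p. 18: "each such vertex has exactly one edge connecting it to `B⟨j⟩`") the leaving coordinate is unique and the other
coordinates are in range; with diagonal steps this fails (corner contacts) — this is the repaired, weaker shape.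
[cite: KozmaNitzan2024, §4 p. 18] -/
theorem exists_dir_of_mem_outerBoundary (hS : AdmissibleSteps d S) {Lo Hi x : Site d}
    (hx : x ∈ outerBoundary (stepGraph d S) (Finset.Icc Lo Hi)) :
    ∃ (i : Fin d) (σ : ℤ) (y : Site d), (σ = 1 ∨ σ = -1) ∧ (σ = 1 ∧ x i = Hi i + 1 ∧ y i = Hi i ∨ σ = -1 ∧ x i = Lo i - 1 ∧ y i = Lo i) ∧
      y ∈ Finset.Icc Lo Hi ∧ (stepGraph d S).Adj y x ∧ ∀ k, Lo k - 1 ≤ x k ∧ x k ≤ Hi k + 1 := by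
  have hx' := hx
  rw [mem_outerBoundary_iff] at hx
  obtain ⟨hxX, y, hy, hxy⟩ := hx
  have hyB := KozmaNitzan.mem_Icc_iff.1 hy
  have hxB : ∀ k, Lo k - 1 ≤ x k ∧ x k ≤ Hi k + 1 := by
    have := KozmaNitzan.mem_Icc_iff.1 (mem_Icc_enlarge_one_of_mem_outerBoundary hS hx')
    intro k; have h := this k
    simp only [Pi.sub_apply, Pi.add_apply, Pi.one_apply] at h
    exact h
  rw [KozmaNitzan.mem_Icc_iff] at hxX
  push Not at hxX
  obtain ⟨i, hi⟩ := hxX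
  have h1 := abs_le.1 (stepGraph_abs_sub_le hS hxy i)
  have h2 := hyB i
  have h3 := hxB i
  by_cases hup : x i = Hi i + 1
  · exact ⟨i, 1, y, Or.inl rfl, Or.inl ⟨rfl, hup, by omega⟩, hy, hxy.symm, hxB⟩
  · have hdown : x i = Lo i - 1 := by omega
    exact ⟨i, -1, y, Or.inr rfl, Or.inr ⟨rfl, hdown, by omega⟩, hy, hxy.symm, hxB⟩

/-- **The window attached to a contact vertex, `stepGraph` version (REPAIRED SHAPE)**: for a box all of whose sides exceed `2M+2` and a
vertex `x` of its outer boundary in `stepGraph d S`, there are a face direction `(i, σ)` and an inner neighbour `y` of `x` on that face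
carrying Kozma–Nitzan's window hypothesis `WinHyp` (so the plaquette/cube/seed construction of the original file applies to `y`
verbatim), with `y ∼ x` in `stepGraph d S` and `x_i = y_i + σ`. [cite: KozmaNitzan2024, §4 pp. 19–21 (plaquettes and seeds at a contact)] -/
theorem exists_winHyp_of_mem_outerBoundary (hS : AdmissibleSteps d S) {Lo Hi : Site d} {M : ℕ}
    (hwide : ∀ k, Lo k + 2 * M + 2 ≤ Hi k) {x : Site d} (hx : x ∈ outerBoundary (stepGraph d S) (Finset.Icc Lo Hi)) :
    ∃ (i : Fin d) (σ : ℤ) (y : Site d), WinHyp Lo Hi M i σ y ∧ (stepGraph d S).Adj y x ∧ x i = y i + σ := by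
  obtain ⟨i, σ, y, hσ, hface, hy, hadj, -⟩ := exists_dir_of_mem_outerBoundary hS hx
  refine ⟨i, σ, y, ⟨hwide, hσ, ?_, KozmaNitzan.mem_Icc_iff.1 hy⟩, hadj, ?_⟩
  · rcases hface with ⟨hs, -, hyi⟩ | ⟨hs, -, hyi⟩
    · exact Or.inl ⟨hs, hyi⟩
    · exact Or.inr ⟨hs, hyi⟩
  · rcases hface with ⟨hs, hxi, hyi⟩ | ⟨hs, hxi, hyi⟩
    · rw [hxi, hyi, hs]
    · rw [hxi, hyi, hs]; ring

/-- **The seed edges are edges of `stepGraph d S`** (they are axis edges of `ℤ^d ≤ stepGraph d S`).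
[cite: KozmaNitzan2024, §4 p. 19 (seeds)] -/
theorem seedEdges_subset_edgeSet (hS : AdmissibleSteps d S) {Lo Hi : Site d} {M : ℕ} {i : Fin d} {σ : ℤ} {y : Site d}
    (h : WinHyp Lo Hi M i σ y) : (↑(seedEdges Lo Hi M i σ y) : Set (Sym2 (Site d))) ⊆ (stepGraph d S).edgeSet :=
  (KozmaNitzan.seedEdges_subset_edgeSet h).trans (SimpleGraph.edgeSet_mono (zdGraph_le_stepGraph hS))

/-! ## Counting: degrees and edges inside a region -/

/-- **Degrees in `stepGraph d S` are at most `2|S|`.** [folklore] -/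
theorem card_neighborFinset_le (S : Finset (Site d)) (x : Site d) : ((stepGraph d S).neighborFinset x).card ≤ 2 * S.card := by
  classical
  have hsub : (stepGraph d S).neighborFinset x ⊆ S.image (fun s => x + s) ∪ S.image (fun s => x - s) := by
    intro y hy
    have hy' : y ∈ (stepGraph d S).neighborSet x := by rwa [SimpleGraph.mem_neighborFinset] at hy
    exact_mod_cast stepGraph_neighborSet_subset S x hy'
  calc ((stepGraph d S).neighborFinset x).card ≤ (S.image (fun s => x + s) ∪ S.image (fun s => x - s)).card := Finset.card_le_card hsub
    _ ≤ (S.image (fun s => x + s)).card + (S.image (fun s => x - s)).card := Finset.card_union_le _ _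
    _ ≤ S.card + S.card := Nat.add_le_add Finset.card_image_le Finset.card_image_le
    _ = 2 * S.card := by ring

/-- **`|E(Λ)| ≤ 2|S|·|Λ|` in `stepGraph d S`** (replaces `KozmaNitzan.card_edgesIn_le`'s `2d·|Λ|`). [folklore] -/
theorem card_edgesIn_le (S : Finset (Site d)) (Λ : Finset (Site d)) : (edgesIn (stepGraph d S) Λ).card ≤ 2 * S.card * Λ.card := by
  classical
  calc (edgesIn (stepGraph d S) Λ).card ≤ (edgesTouching (stepGraph d S) Λ).card :=
        Finset.card_le_card (edgesIn_subset_edgesTouching Λ)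
    _ ≤ ∑ x ∈ Λ, ((stepGraph d S).incidenceFinset x).card := Finset.card_biUnion_le
    _ ≤ ∑ _x ∈ Λ, 2 * S.card := Finset.sum_le_sum fun x _ => by
        rw [SimpleGraph.card_incidenceFinset_eq_degree, ← SimpleGraph.card_neighborFinset_eq_degree]
        exact card_neighborFinset_le S x
    _ = 2 * S.card * Λ.card := by rw [Finset.sum_const, smul_eq_mul, mul_comm]

/-! Regression note: at `S = unitSteps d` these are the original statements up to `stepGraph_unitSteps : stepGraph d (unitSteps d) = zdGraph d`;
a literal `rw` across that identity is blocked by the `LocallyFinite` instance carried by `innerBoundary`/`edgesIn` (motive not type-correct),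
so the regression is by inspection of the statements, not by an `example`. -/

end StepKN

end Transplant

end Summit.CriticalPhenomena.PercolationContinuityZ3.Theorems

end
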